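import Literature.AlgebraicGeometry.HodgeTheory.AlgebraicClassesExteriorProduct
import Literature.AlgebraicGeometry.HodgeTheory.AbelianVarietyPullbackAlgebraicClasses
import Literature.AlgebraicGeometry.Motives.AbelianVarietyProduct
import HarnessLib

/-!
# Products of algebraic classes on a complex abelian variety are algebraic — every bidegree, unconditionally

Topic `Literature/AlgebraicGeometry/HodgeTheory` (theorems only, sorry-free; no definition, no named fact).
On the tree's carrier `algebraicClasses X p = Nᵖ H²ᵖ(X(ℂ); ℂ)` the multiplicativity
`Nˡ H²ˡ ∪ Nᵏ H²ᵏ ⊆ N^{l+k} H^{2(l+k)}` (C. Voisin, *Hodge Theory and Complex Algebraic Geometry II*, Prop. 9.20: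
"`cl(Z · Z') = cl(Z) ∪ cl(Z')`") is in the tree only with a divisor factor
(`AbelianVariety.cupProduct_mem_algebraicClasses_one`, `cupProduct_mem_algebraicClasses_one_left/right`), off range,
or modulo an explicit moving hypothesis (`cupProduct_mem_algebraicClasses_of_moving`,
`cupProduct_mem_algebraicClasses_of_map_diagonal`). For a complex ABELIAN VARIETY `A` it holds outright, by two
tree theorems: Voisin's reduction `a ∪ b = Δ^*(pr₁^* a ∪ pr₂^* b)` with the exterior product algebraic
(`cupProduct_mem_algebraicClasses_of_map_diagonal`, proof of Prop. 9.20 / Prop. 9.21 (i)), and the pull-back of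
algebraic classes along ANY morphism from a smooth projective variety to an abelian variety
(`map_mem_algebraicClasses_of_abelianVariety` — Kleiman's general translate, Fulton App. B.9.2 (a)), applied to the
diagonal `Δ = lift 𝟙 𝟙 : A → A × A`, a morphism to the abelian variety `A × A` (`AbelianVariety.prod`,
`(A.prod A).X = A.X ⊗ A.X` definitionally).

* `AbelianVariety.cupProduct_mem_algebraicClasses` — `a ∈ Nˡ H²ˡ(A)`, `b ∈ Nᵏ H²ᵏ(A) ⟹ a ∪ b ∈ N^{l+k} H^{2(l+k)}(A)`;
* `AbelianVariety.cupProduct_mem_algebraicClasses'` — the same for any proof of `2l + 2k = 2p`.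

Consumers: Hodge rings of abelian varieties generated by divisors and Weil classes (`Summits/HodgeConjecture/…/
Theorems/Ring2TransportWeilTypeGeneralCMField`, `HodgeTheory/WeilTypeHodgeRing`), where products of two Weil classes
of middle degree occur.

## References

* [VoisinHodgeII2003] C. Voisin, *Hodge Theory and Complex Algebraic Geometry II*, CUP (2003), §9.2.4 Prop. 9.20,
  Prop. 9.21 (i) and their proofs.
* [Fulton1998] W. Fulton, *Intersection Theory*, 2nd ed. (1998), §8.3 Example 8.3.7 (intersection product on a
  non-singular variety via the diagonal), §19.2 Cor. 19.2 (b), Appendix B.9.2 (a) (Kleiman).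
* [MumfordAV1970] D. Mumford, *Abelian Varieties* (1970), §1 (1).
-/

noncomputable section

open CategoryTheory AlgebraicGeometry MonoidalCategory CartesianMonoidalCategory Limits
open Literature.AlgebraicTopology.SingularHomology

namespace Literature.AlgebraicGeometry.HodgeTheory

section HodgeTheory

open Motives

/-- **Voisin II Prop. 9.20 on a complex abelian variety (proved)**: for `a ∈ Nˡ H²ˡ(A(ℂ); ℂ)` and
`b ∈ Nᵏ H²ᵏ(A(ℂ); ℂ)`, `a ∪ b ∈ N^{l+k} H^{2(l+k)}(A(ℂ); ℂ)`. Proof: `a ∪ b = Δ^*(pr₁^* a ∪ pr₂^* b)` with the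
exterior product algebraic (`cupProduct_mem_algebraicClasses_of_map_diagonal`), and `Δ^*` preserves algebraic classes
because `Δ : A → A × A` is a morphism from a smooth projective variety to the abelian variety `A.prod A`
(`map_mem_algebraicClasses_of_abelianVariety`). [cite: VoisinHodgeII2003, Prop. 9.20 and proof of Prop. 9.21 (i)]
[cite: Fulton1998, §19.2 Cor. 19.2 (b) and Appendix B.9.2 (a)] -/
theorem AbelianVariety.cupProduct_mem_algebraicClasses (A : AbelianVariety ℂ) {l k : ℕ}
    {a : complexBetti A.X (2 * l)} {b : complexBetti A.X (2 * k)}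
    (ha : a ∈ algebraicClasses A.X l) (hb : b ∈ algebraicClasses A.X k) :
    cupProduct (two_mul_add_two_mul l k) a b ∈ algebraicClasses A.X (l + k) :=
  cupProduct_mem_algebraicClasses_of_map_diagonal (AbelianVariety.isSmoothProjective_holds (A := A))
    (fun _ hc ↦ map_mem_algebraicClasses_of_abelianVariety (AbelianVariety.isSmoothProjective_holds (A := A))
      (A.prod A) (lift (𝟙 A.X) (𝟙 A.X)) hc) ha hb

/-- The same for an arbitrary proof of the degree identity `2l + 2k = 2p`, so that it rewrites the tree's
`cupProduct h a b` terms verbatim. [cite: VoisinHodgeII2003, Prop. 9.20] -/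
theorem AbelianVariety.cupProduct_mem_algebraicClasses' (A : AbelianVariety ℂ) {l k p : ℕ}
    (h : 2 * l + 2 * k = 2 * p) {a : complexBetti A.X (2 * l)} {b : complexBetti A.X (2 * k)}
    (ha : a ∈ algebraicClasses A.X l) (hb : b ∈ algebraicClasses A.X k) :
    cupProduct h a b ∈ algebraicClasses A.X p := by
  obtain rfl : p = l + k := by omega
  exact AbelianVariety.cupProduct_mem_algebraicClasses A ha hb

/-- **`HC(A)` is closed under products on an abelian variety, in the form the Hodge-ring files consume**: if two
complex subspaces `S ⊆ H²ˡ`, `T ⊆ H²ᵏ` consist of algebraic classes, so does every cup product of their members.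
[cite: VoisinHodgeII2003, Prop. 9.20] -/
theorem AbelianVariety.cupProduct_mem_algebraicClasses_of_le (A : AbelianVariety ℂ) {l k p : ℕ}
    (h : 2 * l + 2 * k = 2 * p) {S : Submodule ℂ (complexBetti A.X (2 * l))} {T : Submodule ℂ (complexBetti A.X (2 * k))}
    (hS : S ≤ algebraicClasses A.X l) (hT : T ≤ algebraicClasses A.X k)
    {a : complexBetti A.X (2 * l)} {b : complexBetti A.X (2 * k)} (ha : a ∈ S) (hb : b ∈ T) :
    cupProduct h a b ∈ algebraicClasses A.X p :=
  AbelianVariety.cupProduct_mem_algebraicClasses' A h (hS ha) (hT hb)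

end HodgeTheory

end Literature.AlgebraicGeometry.HodgeTheory

end
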